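import Summits.BirchSwinnertonDyer.BirchSwinnertonDyer.Theorems.ByReductionTypeAtTwoTowerClassKitB
import Summits.BirchSwinnertonDyer.BirchSwinnertonDyer.Theorems.ByReductionTypeAtTwoTowerLayerClasses
import HarnessLib

/-!
# TOWER-road class instances — KIT, part C: the gap certificate in the EXACT (`A_j[2]`) currency with
# VARIABLE counts — no local constants at all (route ByReductionTypeAtTwo, items 19573 / 19271; seat
# bsd-2adic-ord-2, GEN 3)

HONEST FRAMING (cell `bsd-2adic`, run/shared/lean/pub/bsd-2adic/, HUMAN RULINGS D-0036 / D-0054 / D-0074):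
THEOREMS ONLY; nothing asserted; no new named fact; closes nothing by itself.

bsd-2adic-tower-1 proved `#X/(2, T^{2^j})X = #A_j[2]` EXACTLY (`A_j = h_j⁻¹(Sel_{2^∞}(E/ℚ_∞)) ⊆
H¹(ℚ_j, E[2^∞])`, tree `W.selmerInftyPreimage κ j`; `TowerLayer.natCard_quotient_towerIdeal_eq_natCard_layerClasses`,
odd torsion order) and the exact gap reading `KatoHalfPinch.towerGapAtTwo_of_layerClasses_exact`. This
file puts it in the two-count form the engines certify (tower-eng TABLE-TOWER-E1, «induced» columns
`e_j`): a lower count `2^a ≤ #Sel_{2^∞}(E/ℚ_j)[2]` (STRICT, three engines; `Sel ⊆ A`) or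
`2^a ≤ #A_j[2]`, an upper count `#A_{j'}[2] ≤ 2^d` (the engineer's induced-structure count — its
local reading at `v ∣ 2` is to be confirmed by T1/referee against the kernel's `A_j`), and the linear
certificate `d + 1 ≤ 2^{j'} − 2^j + a`; NO local constants (`C_ℓ`, `e_ℓ`, `k_ℓ`) — the relaxed count is
exact. At `(j, j') = (0, 1)` this is the seat's GEN-2 LEVEL-ONE door in certificate currency:
`d₀ = 2 ≤ e₀` and `e₁ ≤ 2` ⇒ `TowerGapAtTwo W` (tower-eng reads `e₁ = 2` on all 80 `λ_an = 2` irreducible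
classes, of which only 21 close by strict counts at `ℚ(ζ₁₆)⁺`). The doors AT `W` are Kit part B
(`…_of_towerGap_of_abbesUllmo`).

References: [GreenbergLNM1716] §1 p. 60, §3 pp. 85–86; [Washington1997] §13.2.
-/

set_option autoImplicit false

noncomputable section

open scoped Classical MatrixGroups ModularForm

open NumberField IsDedekindDomain CongruenceSubgroup WeierstrassCurve Literature.NumberTheory.EllipticCurves
  Literature.NumberTheory.EllipticCurves.ModularForms Literature.NumberTheory.EllipticCurves.Rank1Residual
  Literature.NumberTheory.EllipticCurves.Rank1Residual.Typed
  Summit.BirchSwinnertonDyer.Rank1Residual.X5 Summit.BirchSwinnertonDyer.Rank1Residual.X5.O1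
  Summit.BirchSwinnertonDyer.Rank1Residual.X5.TowerGap Summit.BirchSwinnertonDyer.Rank1Residual
  Summit.BirchSwinnertonDyer.BirchSwinnertonDyer.Theorems.KatoHalfPinch

namespace Summit.BirchSwinnertonDyer.BirchSwinnertonDyer.Theorems.TowerClass

variable (W : WeierstrassCurve ℚ) [W.IsElliptic] [W.IsGloballyMinimal]

omit [W.IsGloballyMinimal] in
/-- **Gap from two EXACT layer counts**: odd torsion order, `j ≤ j'`, `2^a ≤ #A_j[2]`, `#A_{j'}[2] ≤ 2^d`
and `d + 1 ≤ 2^{j'} − 2^j + a` ⇒ `O1.TowerGapAtTwo W` (no local constants). [cite: GreenbergLNM1716, §1 p. 60 and §3 pp. 85–86]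
[cite: Washington1997, §13.2] -/
theorem towerGapAtTwo_of_layerClasses_counts (htors : ¬ 2 ∣ W.torsionOrder) {j j' a d : ℕ}
    (hjj' : j ≤ j')
    (hlow : ∀ κ : ZpExtension ℚ 2, κ.IsCyclotomic →
      2 ^ a ≤ Nat.card {z : W.selmerInftyPreimage κ j // 2 • z = 0})
    (hup : ∀ κ : ZpExtension ℚ 2, κ.IsCyclotomic →
      Nat.card {z : W.selmerInftyPreimage κ j' // 2 • z = 0} ≤ 2 ^ d)
    (had : d + 1 ≤ 2 ^ j' - 2 ^ j + a) : TowerGapAtTwo W := by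
  refine towerGapAtTwo_of_layerClasses_exact W htors hjj' fun κ hκ ↦ ?_
  calc Nat.card {z : W.selmerInftyPreimage κ j' // 2 • z = 0}
      ≤ 2 ^ d := hup κ hκ
    _ < 2 ^ (2 ^ j' - 2 ^ j) * 2 ^ a := by
        rw [← pow_add]; exact Nat.pow_lt_pow_right (by norm_num) (by omega)
    _ ≤ 2 ^ (2 ^ j' - 2 ^ j) * Nat.card {z : W.selmerInftyPreimage κ j // 2 • z = 0} :=
        Nat.mul_le_mul_left _ (hlow κ hκ)

omit [W.IsGloballyMinimal] in
/-- **Gap from a STRICT lower count and an EXACT upper count**: odd torsion order, `j ≤ j'`,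
`2^a ≤ #Sel_{2^∞}(E/ℚ_j)[2]` (`Sel ⊆ A`, so also `≤ #X/(2,T^{2^j})X`), `#A_{j'}[2] ≤ 2^d` and
`d + 1 ≤ 2^{j'} − 2^j + a` ⇒ `O1.TowerGapAtTwo W`. At `(j,j') = (0,1)`: `d₀ ≤ a`, `e₁ ≤ d`, `d ≤ a` —
the LEVEL-ONE door. [cite: GreenbergLNM1716, §1 p. 60 and §3 pp. 85–86] [cite: Washington1997, §13.2] -/
theorem towerGapAtTwo_of_layerSelmer_of_layerClasses_counts (htors : ¬ 2 ∣ W.torsionOrder)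
    {j j' a d : ℕ} (hjj' : j ≤ j')
    (hlow : ∀ κ : ZpExtension ℚ 2, κ.IsCyclotomic →
      2 ^ a ≤ Nat.card {z : W.selmerLayer κ j // 2 • z = 0})
    (hup : ∀ κ : ZpExtension ℚ 2, κ.IsCyclotomic →
      Nat.card {z : W.selmerInftyPreimage κ j' // 2 • z = 0} ≤ 2 ^ d)
    (had : d + 1 ≤ 2 ^ j' - 2 ^ j + a) : TowerGapAtTwo W := by
  intro κ γ hκ hγ _ D
  haveI : Module.Finite (IwasawaAlgebra 2) D.X := D.module_finite_holds hγ
  have hK := Iwasawa.forall_smul_eq_zero_imp_of_not_dvd_torsionOrder W htors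
  refine ⟨2 ^ j, 2 ^ j' - 2 ^ j, ?_⟩
  rw [Nat.add_sub_cancel' (Nat.pow_le_pow_right (by norm_num) hjj'),
    TowerLayer.natCard_quotient_towerIdeal_eq_natCard_layerClasses W κ D hγ hK j']
  calc Nat.card {z : W.selmerInftyPreimage κ j' // 2 • z = 0}
      ≤ 2 ^ d := hup κ hκ
    _ < 2 ^ (2 ^ j' - 2 ^ j) * 2 ^ a := by
        rw [← pow_add]; exact Nat.pow_lt_pow_right (by norm_num) (by omega)
    _ ≤ 2 ^ (2 ^ j' - 2 ^ j) *
          Nat.card (D.X ⧸ (towerIdeal 2 (2 ^ j) • ⊤ : Submodule (IwasawaAlgebra 2) D.X)) :=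
        Nat.mul_le_mul_left _
          ((hlow κ hκ).trans (finite_and_natCard_selmerLayer_pTorsion_le W κ D hK j).2)

end Summit.BirchSwinnertonDyer.BirchSwinnertonDyer.Theorems.TowerClass

end
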